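import Summits.ResolutionOfSingularities.ResolutionOfSingularities.Theorems.PurelyInseparableDim4Scope
import Summits.ResolutionOfSingularities.ResolutionOfSingularities.Theorems.PurelyInseparableDim4NearDim
import Summits.ResolutionOfSingularities.ResolutionOfSingularities.Theorems.PurelyInseparableDim4SpineDictionary
import Mathlib.Algebra.MvPolynomial.NoZeroDivisors
import HarnessLib

/-!
# [OURS · res-dim4-pi · F4-C] SCOPE DYNAMICS, part 4: the DIV CLOCK — total degree pays `q` on every divisor
  edge, so no branch is eventually divisorial and MODE 1h returns infinitely often to the states WITHOUT a
  permissible divisor (every `q ≥ 1`, every field, spine or translated alike)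

Cell `res-dim4-pi` (D-0157 DOOR 2, wave 2), seat `res-dim4-p-6`, desk WORD #31 (c) (F4-C «SCOPE DYNAMICS»);
companion of parts 2a–2c (what a DIV edge does to the `p`-fold locus) — here: what it does to the SIZE of `F`.
Blowing up a permissible divisor `{x_j}` (`q ≤ ord_{(x_j)} F`) divides `F` by `x_j^q`
(`NearDim.X_pow_mul_chartTransform_singleton`); the translation to any point `b` of the chart and the cleaning
do not raise the total degree (`totalDegree_translate_le`, `totalDegree_deletePthPowers_le`).  Hence:

* **`totalDegree_step_singleton_add_le`** — along EVERY divisor edge (any point `b`, child `≠ 0`)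
  `deg F′ + q ≤ deg F`;  `totalDegree_lt_of_edge_singleton`;
* **`no_divisor_branch`** — for `q ≥ 1` there is NO infinite branch all of whose edges blow up permissible
  divisors (the «DIV clock» runs out after `≤ deg F / q` ticks);
* **`exists_no_divisor_of_step1h_branch`** — an infinite MODE-1h branch passes beyond every time through a state
  with NO permissible divisor (MODE 1h = least cardinality must take a divisor when one is permissible:
  `exists_divisor_edge_of_step1h`); the same for every divisor-first rule (`exists_no_divisor_of_stepRule_branch`).
  IN SCOPE a permissible divisor is a 3-dimensional (coordinate-hyperplane) component of the `p`-fold locus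
  (`PermissibleLocus` / `ScopeDictionary`), so an in-scope MODE-1h trap lives off the hyperplane stratum
  infinitely often: the F4-C letter `Φ_C` only has to pay on edges from states whose locus through the origin
  has dimension `≤ 2`, the DIV edges in between are paid by the degree.

Scope (honest): a statement about OUR frame (`CentreBlowup.step`, `PIDim4.Edge/Step1h/StepRule`), all `q ≥ 1`,
all fields; nothing about a particular rule beyond «divisor first».  [OURS · counted 0 · elementary; AI kernel
work, weaker than expert review.]  NOTHING here is a statement about resolution of singularities; resolution in
dimension `≥ 4` / characteristic `p > 0` is NOT proved by anything in this file.
bears_on: LADDER-RESOLUTION:D157-DOOR2 (res-dim4-pi · F4-C SCOPE DYNAMICS).  Host item (DR-157-C):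
`stmt-ResolutionOfSingularities-16155`.
-/

noncomputable section

set_option linter.dupNamespace false -- mandated namespace of this single-conjunct summit

open MvPolynomial Finset

namespace Summit.ResolutionOfSingularities.ResolutionOfSingularities.Theorems.PIDim4

namespace DivClock

open Literature.AlgebraicGeometry.Resolution
open Literature.AlgebraicGeometry.Resolution.CentreBlowup
open Literature.AlgebraicGeometry.Resolution.Hauser2010

variable {K : Type} [Field K]

/-! ## §1 Degree bookkeeping -/

/-- A linear form `xᵢ + c` has total degree `≤ 1`. -/
theorem totalDegree_X_add_C_le (i : Fin 4) (c : K) :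
    ((X i + C c : MvPolynomial (Fin 4) K)).totalDegree ≤ 1 :=
  (totalDegree_add _ _).trans (max_le (totalDegree_X (R := K) i).le (by rw [totalDegree_C]; exact Nat.zero_le 1))

/-- **Translations do not raise the total degree.** [folklore] -/
theorem totalDegree_translate_le (b : Fin 4 → K) (G : MvPolynomial (Fin 4) K) :
    (PointBlowup.translate b G).totalDegree ≤ G.totalDegree := by
  classical
  unfold PointBlowup.translate
  conv_lhs => rw [G.as_sum, map_sum]
  refine (totalDegree_finsetSum _ _).trans (Finset.sup_le fun d hd => ?_)
  rw [aeval_monomial, algebraMap_eq]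
  refine (totalDegree_mul _ _).trans ?_
  rw [totalDegree_C, zero_add, Finsupp.prod]
  refine (totalDegree_finsetProd _ _).trans ?_
  refine le_trans (Finset.sum_le_sum fun i _ => (totalDegree_pow _ _).trans
    (Nat.mul_le_mul_left (d i) (totalDegree_X_add_C_le i (b i)))) ?_
  simp only [mul_one]
  exact le_totalDegree hd

/-- **Cleaning does not raise the total degree.** [folklore] -/
theorem totalDegree_deletePthPowers_le (q : ℕ) (G : MvPolynomial (Fin 4) K) :
    (deletePthPowers q G).totalDegree ≤ G.totalDegree :=
  totalDegree_le_of_support_subset (by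
    rw [SpineDictionary.support_deletePthPowers]
    exact Finset.filter_subset _ _)

/-- **The divisor chart divides the total degree down by `q`**: `deg (chartTransform q {j} j F) + q = deg F`
for a permissible divisor and `F ≠ 0`. [folklore] -/
theorem totalDegree_chartTransform_singleton_add {q : ℕ} {j : Fin 4} {F : MvPolynomial (Fin 4) K}
    (hperm : (q : ℕ∞) ≤ ordAlong {j} F) (hF : F ≠ 0) :
    (chartTransform q {j} j F).totalDegree + q = F.totalDegree := by
  have h := NearDim.X_pow_mul_chartTransform_singleton hperm
  have hCT : chartTransform q {j} j F ≠ 0 := fun h0 => hF (by rw [← h, h0, mul_zero])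
  calc (chartTransform q {j} j F).totalDegree + q
      = ((X j : MvPolynomial (Fin 4) K) ^ q * chartTransform q {j} j F).totalDegree := by
        rw [totalDegree_mul_of_isDomain (pow_ne_zero q (X_ne_zero j)) hCT, totalDegree_X_pow, add_comm]
    _ = F.totalDegree := by rw [h]

/-! ## §2 A divisor edge pays `q` in total degree -/

section Step

variable [DecidableEq K]

/-- The child's residual polynomial (definitional): clean the translate of the chart transform. -/
theorem step_F_eq (q : ℕ) (S : Finset (Fin 4)) (j : Fin 4) (b : Fin 4 → K) (s : State K) :
    (CentreBlowup.step q S j b s).F =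
      deletePthPowers q (PointBlowup.translate b (chartTransform q S j s.F)) :=
  rfl

/-- **`deg F′ + q ≤ deg F` along every divisor edge** (permissible divisor `{x_j}`, any point `b`, child
`F′ ≠ 0`). [folklore] -/
theorem totalDegree_step_singleton_add_le {q : ℕ} {j : Fin 4} (b : Fin 4 → K) (s : State K)
    (hperm : (q : ℕ∞) ≤ ordAlong {j} s.F) (hne : (CentreBlowup.step q {j} j b s).F ≠ 0) :
    (CentreBlowup.step q {j} j b s).F.totalDegree + q ≤ s.F.totalDegree := by
  have hF : s.F ≠ 0 := by
    intro h0
    apply hne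
    rw [step_F_eq, h0]
    unfold chartTransform PointBlowup.translate
    rw [MvPolynomial.support_zero, Finset.sum_empty, map_zero, deletePthPowers_zero]
  rw [← totalDegree_chartTransform_singleton_add hperm hF, step_F_eq]
  exact Nat.add_le_add_right
    ((totalDegree_deletePthPowers_le _ _).trans (totalDegree_translate_le _ _)) q

/-- **Total degree strictly drops along a divisor edge** (`q ≥ 1`). [folklore] -/
theorem totalDegree_lt_of_edge_singleton {q : ℕ} (hq : 0 < q) {j : Fin 4} {s s' : State K}
    (hperm : IsPermissibleCentre q {j} s.F) (h : Edge q {j} s s') :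
    s'.F.totalDegree < s.F.totalDegree := by
  obtain ⟨j', b, hj', -, -, hne, rfl⟩ := h
  rw [Finset.mem_singleton] at hj'
  subst hj'
  have := totalDegree_step_singleton_add_le b s hperm.2 hne
  omega

/-! ## §3 The DIV clock -/

/-- **No infinite branch of divisor edges** (`q ≥ 1`): the total degree would descend for ever. [folklore] -/
theorem no_divisor_branch {q : ℕ} (hq : 0 < q) :
    ¬ ∃ c : ℕ → State K, ∀ k, ∃ j : Fin 4,
      IsPermissibleCentre q {j} (c k).F ∧ Edge q {j} (c k) (c (k + 1)) := by
  rintro ⟨c, hc⟩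
  refine not_strictAnti_of_wellFoundedLT (fun k => (c k).F.totalDegree) (strictAnti_nat_of_succ_lt fun k => ?_)
  obtain ⟨j, hperm, hedge⟩ := hc k
  exact totalDegree_lt_of_edge_singleton hq hperm hedge

/-- **Every infinite branch whose edges are permissible coordinate blow-ups uses a centre of codimension
`≥ 2` (`|S| ≥ 2`) beyond every time** (given with its centres `S k`). [folklore] -/
theorem exists_two_le_card_of_branch {q : ℕ} (hq : 0 < q) (c : ℕ → State K) (S : ℕ → Finset (Fin 4))
    (hc : ∀ k, IsPermissibleCentre q (S k) (c k).F ∧ Edge q (S k) (c k) (c (k + 1))) (N : ℕ) :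
    ∃ k, N ≤ k ∧ 2 ≤ (S k).card := by
  by_contra h
  push Not at h
  refine no_divisor_branch (K := K) hq ⟨fun k => c (N + k), fun k => ?_⟩
  have hcard : (S (N + k)).card = 1 := by
    have h1 := h (N + k) (Nat.le_add_right N k)
    have h0 : 0 < (S (N + k)).card := Finset.card_pos.mpr (hc (N + k)).1.1
    omega
  obtain ⟨j, hj⟩ := Finset.card_eq_one.mp hcard
  refine ⟨j, ?_, ?_⟩
  · rw [← hj]; exact (hc (N + k)).1
  · rw [← hj]
    exact (hc (N + k)).2

/-! ## §4 MODE 1h and divisor-first rules -/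

omit [DecidableEq K] in
/-- **MODE 1h takes a divisor when one is permissible**: then every MODE-1h centre is a divisor. [folklore] -/
theorem exists_eq_singleton_of_isMode1hCentre {q : ℕ} {S : Finset (Fin 4)} {F : MvPolynomial (Fin 4) K}
    (hS : IsMode1hCentre q S F) (h : ∃ j : Fin 4, IsPermissibleCentre q {j} F) :
    ∃ j : Fin 4, S = {j} := by
  obtain ⟨j, hj⟩ := h
  have hle : S.card ≤ 1 := by simpa using hS.2 {j} hj
  have hpos : 0 < S.card := Finset.card_pos.mpr hS.1.1
  exact Finset.card_eq_one.mp (by omega)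

/-- A MODE-1h edge from a state with a permissible divisor is a divisor edge. [folklore] -/
theorem exists_divisor_edge_of_step1h {q : ℕ} {s s' : State K} (h : Step1h q s s')
    (hdiv : ∃ j : Fin 4, IsPermissibleCentre q {j} s.F) :
    ∃ j : Fin 4, IsPermissibleCentre q {j} s.F ∧ Edge q {j} s s' := by
  obtain ⟨S, hS, hedge⟩ := h
  obtain ⟨j, rfl⟩ := exists_eq_singleton_of_isMode1hCentre hS hdiv
  exact ⟨j, hS.1, hedge⟩

/-- **An infinite MODE-1h branch passes beyond every time through a state WITHOUT a permissible divisor**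
(`q ≥ 1`, every field, spine or translated alike). [folklore] -/
theorem exists_no_divisor_of_step1h_branch {q : ℕ} (hq : 0 < q) (c : ℕ → State K)
    (hc : ∀ k, Step1h q (c k) (c (k + 1))) (N : ℕ) :
    ∃ k, N ≤ k ∧ ∀ j : Fin 4, ¬ IsPermissibleCentre q {j} (c k).F := by
  by_contra h
  push Not at h
  refine no_divisor_branch (K := K) hq ⟨fun k => c (N + k), fun k => ?_⟩
  obtain ⟨j, hj⟩ := h (N + k) (Nat.le_add_right N k)
  obtain ⟨j', hperm, hedge⟩ := exists_divisor_edge_of_step1h (hc (N + k)) ⟨j, hj⟩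
  exact ⟨j', hperm, hedge⟩

/-- Hence **`Terminates1h` can only fail through states without a permissible divisor**: a MODE-1h branch all
of whose states (beyond some time) have a permissible divisor does not exist. [folklore] -/
theorem no_step1h_branch_of_eventually_divisor {q : ℕ} (hq : 0 < q) (c : ℕ → State K)
    (hc : ∀ k, Step1h q (c k) (c (k + 1))) (N : ℕ)
    (hdiv : ∀ k, N ≤ k → ∃ j : Fin 4, IsPermissibleCentre q {j} (c k).F) : False := by
  obtain ⟨k, hk, hno⟩ := exists_no_divisor_of_step1h_branch hq c hc N
  obtain ⟨j, hj⟩ := hdiv k hk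
  exact hno j hj

/-- The same for every **divisor-first** rule `R` (a rule that answers a divisor whenever some divisor is
permissible — MODE 1h, MODE S and the engines' cardinality-first rules all do). [folklore] -/
theorem exists_no_divisor_of_stepRule_branch {q : ℕ} (hq : 0 < q) (R : CentreRule K)
    (hR : ∀ s : State K, (∃ j : Fin 4, IsPermissibleCentre q {j} s.F) → ∃ j : Fin 4, R s = {j})
    (c : ℕ → State K) (hc : ∀ k, StepRule q R (c k) (c (k + 1))) (N : ℕ) :
    ∃ k, N ≤ k ∧ ∀ j : Fin 4, ¬ IsPermissibleCentre q {j} (c k).F := by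
  by_contra h
  push Not at h
  refine no_divisor_branch (K := K) hq ⟨fun k => c (N + k), fun k => ?_⟩
  obtain ⟨j, hj⟩ := hR (c (N + k)) (h (N + k) (Nat.le_add_right N k))
  refine ⟨j, ?_, ?_⟩
  · have := (hc (N + k)).1; rwa [hj] at this
  · have := (hc (N + k)).2
    rw [hj] at this
    exact this

/-- **In-scope reading** (F4-C): an infinite IN-SCOPE MODE-1h branch passes beyond every time through an
in-scope state without a permissible divisor, i.e. (by the scope dictionary) whose `q`-fold locus through the
origin has no hyperplane component. [folklore] -/
theorem exists_inScope_no_divisor_of_step1h_branch {q : ℕ} (hq : 0 < q) (c : ℕ → State K)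
    (hc : ∀ k, InCoordinateScope q (c k).F ∧ Step1h q (c k) (c (k + 1))) (N : ℕ) :
    ∃ k, N ≤ k ∧ InCoordinateScope q (c k).F ∧ ∀ j : Fin 4, ¬ IsPermissibleCentre q {j} (c k).F := by
  obtain ⟨k, hk, hno⟩ := exists_no_divisor_of_step1h_branch hq c (fun k => (hc k).2) N
  exact ⟨k, hk, (hc k).1, hno⟩

end Step

end DivClock

end Summit.ResolutionOfSingularities.ResolutionOfSingularities.Theorems.PIDim4

end
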